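import Literature.Geometry.Riemannian.HeatKernelFnUpperBound
import Literature.Geometry.Riemannian.KernelNashEntropy
import Literature.Geometry.Riemannian.RicciFlowUniformComparison
import Mathlib.Analysis.SpecialFunctions.Pow.Asymptotics
import HarnessLib

/-!
# The pointed Nash entropy of the conjugate heat kernel at the pole: `τ 𝒩_{x₀,t₀}(τ) → 0`, and
# Bamler's Prop. 5.2 / entropy floor for KERNELS (Bamler 2020a, §5.1)

R. Bamler, *Entropy and heat kernel bounds on a Ricci flow background*, arXiv:2008.07093 (2020a),
§5.1, Prop. 5.2 and the display after it: for the conjugate heat kernel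
`dν_{x₀,t₀;t} = K(x₀,t₀;·,t) dg_t`, `τ 𝒩_{x₀,t₀}(τ) = ∫₀^τ 𝒲`, `𝒩 ≥ 𝒲`, and
`𝒩_{x₀,t₀}(τ) ≥ (1/τ)∫₀^τ μ[g_{t₀−τ'}, τ'] dτ'` ("so a lower bound on the pointed Nash entropy
is common"). `KernelNashEntropy.lean` has these on compact sub-intervals `[r₁, r₂] ⊂ (a, t₀)`;
the passage `r₂ → t₀` needs `(t₀ − r) 𝒩(r) → 0`, which we prove from the on-diagonal bound
`K ≤ C (t₀ − r)^{-m/2}` (`IsRicciFlow.exists_heatKernelFn_le`, Nash's argument) and the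
elementary `−u log u ≤ 1 − u`:

* `IsRicciFlow.tendsto_mul_kernelNashEntropy` — `(t₀ − r) 𝒩(r) → 0` as `r → t₀⁻`;
* `IsRicciFlow.kernelNashEntropy_ge_of_le_muEntropy` — **entropy floor**: if
  `μ[g(s), t₀ − s] ≥ F` for `s ∈ [r₁, t₀)` then `𝒩(r₁) ≥ F`;
* `IsRicciFlow.kernelWEntropy_le_kernelNashEntropy` — `𝒲(r₁) ≤ 𝒩(r₁)` (Prop. 5.2, `𝒩 ≥ 𝒲`);
* `IsRicciFlow.tendsto_integral_kernelWEntropy` — `∫_{r₁}^{r₂} 𝒲 → (t₀ − r₁) 𝒩(r₁)` as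
  `r₂ → t₀⁻` (Prop. 5.2, `τ𝒩(τ) = ∫₀^τ 𝒲`).

Here `u r y = K(x₀,t₀;y,r)` (`heatKernelFn`), `𝒩(r) = pointedNashEntropy g u m t₀ r = 𝒩_{x₀,t₀}(t₀−r)`
and `𝒲(s) = 𝒲[g(s), f(s), t₀ − s]`. Everything is proved; no definitions, no named facts.

## References

* R. H. Bamler, *Entropy and heat kernel bounds on a Ricci flow background*, arXiv:2008.07093
  (2020), §5.1, Def. 5.1, Prop. 5.2. [Bamler2020Entropy]
-/

noncomputable section

open Bundle Set Function Filter Manifold MeasureTheory Measure TopologicalSpace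
open scoped Manifold ContDiff Topology ENNReal NNReal

namespace Literature.Geometry.Riemannian

open Lorentzian Lorentzian.PseudoRiemannianMetric

/-- `−u log u ≤ 1 − u` for `u > 0` (`log(1/u) ≤ 1/u − 1`). [folklore] -/
theorem neg_mul_log_le_one_sub {u : ℝ} (hu : 0 < u) : -(u * Real.log u) ≤ 1 - u := by
  have h := Real.log_le_sub_one_of_pos (inv_pos.2 hu)
  rw [Real.log_inv] at h
  have := mul_le_mul_of_nonneg_left h hu.le
  rw [mul_sub, mul_inv_cancel₀ hu.ne', mul_one] at this
  linarith

/-- `−u log u ≥ −u log Λ` for `0 < u ≤ Λ`. [folklore] -/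
theorem neg_mul_log_ge {u Λ : ℝ} (hu : 0 < u) (huΛ : u ≤ Λ) : -(u * Real.log Λ) ≤ -(u * Real.log u) := by
  have := Real.log_le_log hu huΛ
  nlinarith

section Pole

variable {m : ℕ} {H : Type*} [TopologicalSpace H]
  {I : ModelWithCorners ℝ (EuclideanSpace ℝ (Fin m)) H} [I.Boundaryless]
  {M : Type*} [TopologicalSpace M] [ChartedSpace H M] [IsManifold I ∞ M]
  [T2Space M] [CompactSpace M] [SecondCountableTopology M] [MeasurableSpace M] [BorelSpace M]
  [PreconnectedSpace M]
  {g : ℝ → PseudoRiemannianMetric I ∞ (EuclideanSpace ℝ (Fin m)) (TangentSpace I : M → Type _)}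
  {cov : ℝ → CovariantDerivative I (EuclideanSpace ℝ (Fin m)) (TangentSpace I : M → Type _)}
  {a T : ℝ} (hflow : IsRicciFlow g cov (Icc a T)) (hh : IsContMDiffFamilyOn ∞ g univ)
  (hR' : ∀ r, (g r).IsRiemannian)

include hflow hR' in
omit [SecondCountableTopology M] [PreconnectedSpace M] in
/-- **Uniform volume bound along the flow**: `Vol(g(r)) ≤ V̄` for `r ∈ [a, T]`.
[cite: Topping2006, (2.5.7)] -/
theorem IsRicciFlow.exists_measureReal_univ_le (haT : a < T) :
    ∃ V : ℝ, 0 ≤ V ∧ ∀ r ∈ Icc a T, (g r).riemVolume.real univ ≤ V := by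
  have hflow₁ : IsRicciFlow (fun r ↦ g (r + a)) (fun r ↦ cov (r + a)) (Icc 0 (T - a)) := by
    refine (hflow.comp_add_const a).mono fun r hr ↦ ?_
    exact ⟨by linarith [hr.1], by linarith [hr.2]⟩
  obtain ⟨C, -, hC⟩ := hflow₁.exists_riemVolume_le_smul_Icc (sub_pos.2 haT) (fun r _ ↦ hR' _)
  haveI : IsFiniteMeasure (g a).riemVolume := ⟨(g a).riemVolume_univ_lt_top⟩
  refine ⟨(C : ℝ) * (g a).riemVolume.real univ, by positivity, fun r hr ↦ ?_⟩
  have h1 := (hC (r - a) ⟨by linarith [hr.1], by linarith [hr.2]⟩).1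
  simp only [sub_add_cancel, zero_add] at h1
  have h2 : (g r).riemVolume univ ≤ (C • (g a).riemVolume) univ := h1 univ
  rw [Measure.smul_apply] at h2
  have h3 : ((g r).riemVolume univ).toReal ≤ ((C : ℝ≥0∞) • (g a).riemVolume univ).toReal :=
    ENNReal.toReal_mono (by simp [ENNReal.mul_eq_top, measure_ne_top]) (by simpa using h2)
  simpa [measureReal_def, ENNReal.toReal_mul] using h3

/-- **The pointed Nash entropy of the kernel, explicitly**: for `r ∈ (a, t₀)`,
`𝒩(r) = ∫ (−u log u) dV_r − (m/2) log(4π(t₀ − r)) − m/2` (`∫ u dV_r = 1`).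
[cite: Bamler2020Entropy, §5.1, Def. 5.1] -/
theorem IsRicciFlow.kernelNashEntropy_eq {t₀ : ℝ} (ht₀ : t₀ ∈ Ioc a T) (x₀ : M) {r : ℝ}
    (hr : r ∈ Ioo a t₀) :
    pointedNashEntropy g (fun r y ↦ hflow.heatKernelFn hh hR' t₀ x₀ (y, r)) m t₀ r =
      ∫ y, -(hflow.heatKernelFn hh hR' t₀ x₀ (y, r) *
          Real.log (hflow.heatKernelFn hh hR' t₀ x₀ (y, r))) ∂(g r).riemVolume -
        (m : ℝ) / 2 * Real.log (4 * Real.pi * (t₀ - r)) - (m : ℝ) / 2 := by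
  haveI : IsFiniteMeasure (g r).riemVolume := ⟨(g r).riemVolume_univ_lt_top⟩
  set K : M → ℝ := fun y ↦ hflow.heatKernelFn hh hR' t₀ x₀ (y, r) with hK
  have hKc : Continuous K := hflow.continuous_heatKernelFn_slice hh hR' ht₀ x₀ hr
  have hKpos : ∀ y, 0 < K y := fun y ↦ hflow.heatKernelFn_pos hh hR' ht₀ x₀ ⟨mem_univ _, hr⟩
  have hlogc : Continuous fun y ↦ Real.log (K y) :=
    Real.continuousOn_log.comp_continuous hKc fun y ↦ (hKpos y).ne'
  have hi : ∀ {f : M → ℝ}, Continuous f → Integrable f (g r).riemVolume := fun hf ↦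
    hf.integrable_of_hasCompactSupport (HasCompactSupport.of_compactSpace _)
  have hmass : ∫ y, K y ∂(g r).riemVolume = 1 := hflow.integral_heatKernelFn_eq_one hh hR' ht₀ x₀ hr
  rw [pointedNashEntropy_def]
  simp only [entropyPotential_apply]
  have e : (fun y ↦ (-Real.log (K y) - (m : ℝ) / 2 * Real.log (4 * Real.pi * (t₀ - r))) * K y) =
      fun y ↦ -(K y * Real.log (K y)) - (m : ℝ) / 2 * Real.log (4 * Real.pi * (t₀ - r)) * K y := by
    funext y; ring
  show (∫ y, (-Real.log (K y) - (m : ℝ) / 2 * Real.log (4 * Real.pi * (t₀ - r))) * K y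
    ∂(g r).riemVolume) - (m : ℝ) / 2 = _
  have hI1 : Integrable (fun y ↦ -(K y * Real.log (K y))) (g r).riemVolume :=
    (hi (hKc.mul hlogc)).neg
  have hI2 : Integrable (fun y ↦ (m : ℝ) / 2 * Real.log (4 * Real.pi * (t₀ - r)) * K y)
      (g r).riemVolume := (hi hKc).const_mul _
  rw [e, integral_sub hI1 hI2, integral_const_mul, hmass, mul_one]

/-- **`(t₀ − r) 𝒩_{x₀,t₀}(t₀ − r) → 0` as `r → t₀⁻`** (the behaviour of the pointed Nash entropy
of the conjugate heat kernel at the pole, used in Bamler 2020a, Prop. 5.2 to integrate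
`d/dτ(τ𝒩) = 𝒲` from `τ = 0`): `(t₀ − r)𝒩(r) = τ∫(−u log u) − (m/2)τ log(4πτ) − (m/2)τ`, where
`−log(C τ^{-m/2}) ≤ ∫(−u log u) dV_r ≤ Vol(g(r))` by `u ≤ C τ^{-m/2}`
(`IsRicciFlow.exists_heatKernelFn_le`), `∫ u = 1` and `−u log u ≤ 1 − u`.
[cite: Bamler2020Entropy, §5.1, Prop. 5.2] -/
theorem IsRicciFlow.tendsto_mul_kernelNashEntropy (hm : 3 ≤ m) {t₀ : ℝ} (ht₀ : t₀ ∈ Ioc a T)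
    (x₀ : M) :
    Tendsto (fun r ↦ (t₀ - r) *
      pointedNashEntropy g (fun r y ↦ hflow.heatKernelFn hh hR' t₀ x₀ (y, r)) m t₀ r)
      (𝓝[<] t₀) (𝓝 0) := by
  have haT : a < T := ht₀.1.trans_le ht₀.2
  obtain ⟨C, hC0, hC⟩ := hflow.exists_heatKernelFn_le hh hR' haT hm
  obtain ⟨V, hV0, hV⟩ := hflow.exists_measureReal_univ_le hR' haT
  set C' : ℝ := max C 1 with hC'
  have hC'1 : 1 ≤ C' := le_max_right _ _
  have hmR : (0 : ℝ) < m := by exact_mod_cast (show 0 < m by omega)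
  -- abbreviations
  set N : ℝ → ℝ := fun r ↦
    pointedNashEntropy g (fun r y ↦ hflow.heatKernelFn hh hR' t₀ x₀ (y, r)) m t₀ r with hN
  set S : ℝ → ℝ := fun r ↦ ∫ y, -(hflow.heatKernelFn hh hR' t₀ x₀ (y, r) *
    Real.log (hflow.heatKernelFn hh hR' t₀ x₀ (y, r))) ∂(g r).riemVolume with hS
  -- the window `r ∈ (max a (t₀ - 1), t₀)`
  set r₀ : ℝ := max a (t₀ - 1) with hr₀
  have hr₀t : r₀ < t₀ := max_lt ht₀.1 (by linarith)
  have hwin : ∀ᶠ r in 𝓝[<] t₀, r ∈ Ioo r₀ t₀ := Ioo_mem_nhdsLT hr₀t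
  -- bounds for `S r` on the window
  have hSbounds : ∀ r ∈ Ioo r₀ t₀,
      -(Real.log C' - (m : ℝ) / 2 * Real.log (t₀ - r)) ≤ S r ∧ S r ≤ V := by
    intro r hr
    have har : a < r := (le_max_left _ _).trans_lt hr.1
    have hr1 : t₀ - 1 < r := (le_max_right _ _).trans_lt hr.1
    have hr' : r ∈ Ioo a t₀ := ⟨har, hr.2⟩
    have hrT : r ∈ Icc a T := ⟨har.le, hr.2.le.trans ht₀.2⟩
    have hτ0 : 0 < t₀ - r := sub_pos.2 hr.2
    have hτ1 : t₀ - r < 1 := by linarith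
    haveI : IsFiniteMeasure (g r).riemVolume := ⟨(g r).riemVolume_univ_lt_top⟩
    set K : M → ℝ := fun y ↦ hflow.heatKernelFn hh hR' t₀ x₀ (y, r) with hK
    have hKc : Continuous K := hflow.continuous_heatKernelFn_slice hh hR' ht₀ x₀ hr'
    have hKpos : ∀ y, 0 < K y := fun y ↦ hflow.heatKernelFn_pos hh hR' ht₀ x₀ ⟨mem_univ _, hr'⟩
    have hlogc : Continuous fun y ↦ Real.log (K y) :=
      Real.continuousOn_log.comp_continuous hKc fun y ↦ (hKpos y).ne'
    have hi : ∀ {f : M → ℝ}, Continuous f → Integrable f (g r).riemVolume := fun hf ↦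
      hf.integrable_of_hasCompactSupport (HasCompactSupport.of_compactSpace _)
    have hmass : ∫ y, K y ∂(g r).riemVolume = 1 :=
      hflow.integral_heatKernelFn_eq_one hh hR' ht₀ x₀ hr'
    -- the sup bound `K ≤ Λ = C' (t₀ - r)^{-m/2}`, `Λ ≥ 1`
    set Λ : ℝ := C' * (t₀ - r) ^ (-((m : ℝ) / 2)) with hΛ
    have hpow1 : 1 ≤ (t₀ - r) ^ (-((m : ℝ) / 2)) := by
      rw [Real.rpow_neg hτ0.le]
      exact one_le_inv₀ (Real.rpow_pos_of_pos hτ0 _) |>.2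
        (Real.rpow_le_one hτ0.le hτ1.le (by positivity))
    have hΛ1 : 1 ≤ Λ := by rw [hΛ]; nlinarith
    have hKΛ : ∀ y, K y ≤ Λ := fun y ↦
      (hC t₀ ht₀ x₀ r hr' y).trans (mul_le_mul_of_nonneg_right (le_max_left _ _)
        (zero_le_one.trans hpow1))
    have hlogΛ : Real.log Λ = Real.log C' - (m : ℝ) / 2 * Real.log (t₀ - r) := by
      rw [hΛ, Real.log_mul (by positivity) (by positivity), Real.log_rpow hτ0]; ring
    constructor
    · -- lower bound: `S ≥ -log Λ ∫ K = -log Λ`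
      rw [← hlogΛ]
      have h1 : ∫ y, -(K y * Real.log Λ) ∂(g r).riemVolume ≤ S r :=
        integral_mono ((hi hKc).mul_const _).neg (hi (hKc.mul hlogc)).neg fun y ↦
          neg_mul_log_ge (hKpos y) (hKΛ y)
      rw [integral_neg, integral_mul_const, hmass, one_mul] at h1
      exact h1
    · -- upper bound: `S ≤ ∫ (1 - K) ≤ Vol`
      have h1 : S r ≤ ∫ y, (1 - K y) ∂(g r).riemVolume :=
        integral_mono (hi (hKc.mul hlogc)).neg ((integrable_const 1).sub (hi hKc)) fun y ↦
          neg_mul_log_le_one_sub (hKpos y)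
      rw [integral_sub (integrable_const 1) (hi hKc), hmass, integral_const, smul_eq_mul,
        mul_one] at h1
      linarith [hV r hrT]
  -- the identity `(t₀ - r) N r = τ S - (m/2) τ log(4πτ) - (m/2) τ` on the window
  have hident : ∀ r ∈ Ioo r₀ t₀, (t₀ - r) * N r =
      (t₀ - r) * S r - (m : ℝ) / 2 * ((t₀ - r) * Real.log (4 * Real.pi * (t₀ - r))) -
        (m : ℝ) / 2 * (t₀ - r) := by
    intro r hr
    have hr' : r ∈ Ioo a t₀ := ⟨(le_max_left _ _).trans_lt hr.1, hr.2⟩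
    rw [hN]
    simp only
    rw [hflow.kernelNashEntropy_eq hh hR' ht₀ x₀ hr']
    ring
  -- elementary limits in `τ = t₀ - r → 0⁺`
  have hτ : Tendsto (fun r ↦ t₀ - r) (𝓝[<] t₀) (𝓝[>] 0) := by
    refine tendsto_nhdsWithin_iff.2 ⟨?_, ?_⟩
    · have : Tendsto (fun r ↦ t₀ - r) (𝓝 t₀) (𝓝 (t₀ - t₀)) :=
        (continuous_const.sub continuous_id).tendsto t₀
      rw [sub_self] at this
      exact this.mono_left nhdsWithin_le_nhds
    · exact eventually_nhdsWithin_of_forall fun r hr ↦ mem_Ioi.2 (sub_pos.2 hr)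
  have hτ0 : Tendsto (fun r ↦ t₀ - r) (𝓝[<] t₀) (𝓝 0) :=
    hτ.mono_right nhdsWithin_le_nhds
  -- `τ log τ → 0`
  have hτlog : Tendsto (fun r ↦ (t₀ - r) * Real.log (t₀ - r)) (𝓝[<] t₀) (𝓝 0) := by
    have h1 := (tendsto_log_mul_rpow_nhdsGT_zero zero_lt_one).comp hτ
    refine h1.congr' (eventually_nhdsWithin_of_forall fun r _ ↦ ?_)
    simp [Real.rpow_one, mul_comm]
  -- `τ log(4πτ) = τ log(4π) + τ log τ → 0`
  have hτlog4 : Tendsto (fun r ↦ (t₀ - r) * Real.log (4 * Real.pi * (t₀ - r))) (𝓝[<] t₀) (𝓝 0) := by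
    have h1 : Tendsto (fun r ↦ (t₀ - r) * Real.log (4 * Real.pi) + (t₀ - r) * Real.log (t₀ - r))
        (𝓝[<] t₀) (𝓝 (0 * Real.log (4 * Real.pi) + 0)) := (hτ0.mul_const _).add hτlog
    rw [zero_mul, zero_add] at h1
    refine h1.congr' ?_
    filter_upwards [self_mem_nhdsWithin] with r hr
    rw [Real.log_mul (by positivity) (sub_pos.2 hr).ne']
    ring
  -- squeeze
  have hlow : Tendsto (fun r ↦ -((t₀ - r) * Real.log C') + (m : ℝ) / 2 * ((t₀ - r) * Real.log (t₀ - r)) -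
      (m : ℝ) / 2 * ((t₀ - r) * Real.log (4 * Real.pi * (t₀ - r))) - (m : ℝ) / 2 * (t₀ - r))
      (𝓝[<] t₀) (𝓝 0) := by
    have := (((hτ0.mul_const (Real.log C')).neg.add (hτlog.const_mul ((m : ℝ) / 2))).sub
      (hτlog4.const_mul ((m : ℝ) / 2))).sub (hτ0.const_mul ((m : ℝ) / 2))
    simpa using this
  have hup : Tendsto (fun r ↦ (t₀ - r) * V -
      (m : ℝ) / 2 * ((t₀ - r) * Real.log (4 * Real.pi * (t₀ - r))) - (m : ℝ) / 2 * (t₀ - r))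
      (𝓝[<] t₀) (𝓝 0) := by
    have := ((hτ0.mul_const V).sub (hτlog4.const_mul ((m : ℝ) / 2))).sub
      (hτ0.const_mul ((m : ℝ) / 2))
    simpa using this
  refine tendsto_of_tendsto_of_tendsto_of_le_of_le' hlow hup ?_ ?_
  · filter_upwards [hwin] with r hr
    rw [hident r hr]
    have hτpos : 0 < t₀ - r := sub_pos.2 hr.2
    have h1 := (hSbounds r hr).1
    nlinarith
  · filter_upwards [hwin] with r hr
    rw [hident r hr]
    have hτpos : 0 < t₀ - r := sub_pos.2 hr.2
    have h2 := (hSbounds r hr).2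
    nlinarith

/-- **The entropy floor for the conjugate heat kernel** (Bamler 2020a, display after Prop. 5.2,
"`𝒩_{x₀,t₀}(τ) ≥ (1/τ)∫₀^τ μ[g_{t₀−τ'}, τ'] dτ'` … so a lower bound on the pointed Nash entropy is
common in Ricci flows"): if Perelman's `μ[g(s), t₀ − s] ≥ F` for all `s ∈ [r₁, t₀)`, then
`𝒩(r₁) = 𝒩_{x₀,t₀}(t₀ − r₁) ≥ F` (the finite-interval floor of `KernelNashEntropy.lean` and
`(t₀ − r₂)𝒩(r₂) → 0`). [cite: Bamler2020Entropy, §5.1, display after Prop. 5.2] -/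
theorem IsRicciFlow.kernelNashEntropy_ge_of_le_muEntropy (hm : 3 ≤ m) {t₀ : ℝ}
    (ht₀ : t₀ ∈ Ioc a T) (x₀ : M) {r₁ : ℝ} (hr₁ : r₁ ∈ Ioo a t₀) {F : ℝ}
    (hF : ∀ s ∈ Ico r₁ t₀, ((F : ℝ) : EReal) ≤ (g s).muEntropy (cov s) (t₀ - s)) :
    F ≤ pointedNashEntropy g (fun r y ↦ hflow.heatKernelFn hh hR' t₀ x₀ (y, r)) m t₀ r₁ := by
  set N : ℝ → ℝ := fun r ↦
    pointedNashEntropy g (fun r y ↦ hflow.heatKernelFn hh hR' t₀ x₀ (y, r)) m t₀ r with hN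
  have hlim := hflow.tendsto_mul_kernelNashEntropy hh hR' hm ht₀ x₀
  -- the finite-interval floor for `r₂ ∈ (r₁, t₀)`
  have hfloor : ∀ r₂ ∈ Ioo r₁ t₀, (t₀ - r₂) * N r₂ + (r₂ - r₁) * F ≤ (t₀ - r₁) * N r₁ := by
    intro r₂ hr₂
    have hflow' : IsRicciFlow g cov (Icc r₁ r₂) :=
      hflow.mono (Icc_subset_Icc hr₁.1.le (hr₂.2.le.trans ht₀.2))
    exact hflow'.mul_kernelNashEntropy_add_mul_le hh hR' (hflow.heatKernelFn_contMDiffOn hh hR' ht₀ x₀)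
      (fun p hp ↦ hflow.heatKernelFn_pos hh hR' ht₀ x₀ hp)
      (fun s hs ↦ hflow.heatKernelMeasure_eq_withDensity_heatKernelFn hh hR' ht₀ x₀ hs)
      (fun p hp ↦ hflow.deriv_heatKernelFn_time hh hR' ht₀ x₀ hp) hr₁.1 hr₂.1 hr₂.2
      fun s hs ↦ hF s ⟨hs.1, hs.2.trans_lt hr₂.2⟩
  -- pass to the limit `r₂ → t₀⁻`
  have h1 : Tendsto (fun r₂ ↦ (t₀ - r₂) * N r₂ + (r₂ - r₁) * F) (𝓝[<] t₀)
      (𝓝 (0 + (t₀ - r₁) * F)) := by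
    refine hlim.add ?_
    have : Tendsto (fun r₂ ↦ (r₂ - r₁) * F) (𝓝 t₀) (𝓝 ((t₀ - r₁) * F)) :=
      ((continuous_id.sub continuous_const).mul continuous_const).tendsto t₀
    exact this.mono_left nhdsWithin_le_nhds
  rw [zero_add] at h1
  have h2 : (t₀ - r₁) * F ≤ (t₀ - r₁) * N r₁ :=
    le_of_tendsto h1 (by
      filter_upwards [Ioo_mem_nhdsLT hr₁.2] with r₂ hr₂ using hfloor r₂ hr₂)
  exact le_of_mul_le_mul_left h2 (sub_pos.2 hr₁.2)

/-- **`𝒲 ≤ 𝒩` for the conjugate heat kernel** (Bamler 2020a, Prop. 5.2: `τ𝒩(τ)` is concave with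
`τ𝒩(τ) → 0`, so `𝒩_{x₀,t₀}(τ) ≥ 𝒲`): `𝒲[g(r₁), f(r₁), t₀ − r₁] ≤ 𝒩(r₁)` for `r₁ ∈ (a, t₀)`.
[cite: Bamler2020Entropy, §5.1, Prop. 5.2] -/
theorem IsRicciFlow.kernelWEntropy_le_kernelNashEntropy (hm : 3 ≤ m) {t₀ : ℝ}
    (ht₀ : t₀ ∈ Ioc a T) (x₀ : M) {r₁ : ℝ} (hr₁ : r₁ ∈ Ioo a t₀) :
    (g r₁).wEntropy (cov r₁)
        (entropyPotential (fun r y ↦ hflow.heatKernelFn hh hR' t₀ x₀ (y, r)) m t₀ r₁) (t₀ - r₁) ≤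
      pointedNashEntropy g (fun r y ↦ hflow.heatKernelFn hh hR' t₀ x₀ (y, r)) m t₀ r₁ := by
  set N : ℝ → ℝ := fun r ↦
    pointedNashEntropy g (fun r y ↦ hflow.heatKernelFn hh hR' t₀ x₀ (y, r)) m t₀ r with hN
  set W₁ : ℝ := (g r₁).wEntropy (cov r₁)
    (entropyPotential (fun r y ↦ hflow.heatKernelFn hh hR' t₀ x₀ (y, r)) m t₀ r₁) (t₀ - r₁) with hW₁
  have hlim := hflow.tendsto_mul_kernelNashEntropy hh hR' hm ht₀ x₀
  have hsand : ∀ r₂ ∈ Ioo r₁ t₀, (r₂ - r₁) * W₁ ≤ (t₀ - r₁) * N r₁ - (t₀ - r₂) * N r₂ := by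
    intro r₂ hr₂
    have hflow' : IsRicciFlow g cov (Icc r₁ r₂) :=
      hflow.mono (Icc_subset_Icc hr₁.1.le (hr₂.2.le.trans ht₀.2))
    exact (hflow'.mul_kernelWEntropy_le_and_le hh hR' (hflow.heatKernelFn_contMDiffOn hh hR' ht₀ x₀)
      (fun p hp ↦ hflow.heatKernelFn_pos hh hR' ht₀ x₀ hp)
      (fun s hs ↦ hflow.heatKernelMeasure_eq_withDensity_heatKernelFn hh hR' ht₀ x₀ hs)
      (fun p hp ↦ hflow.deriv_heatKernelFn_time hh hR' ht₀ x₀ hp) hr₁.1 hr₂.1 hr₂.2).1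
  have h1 : Tendsto (fun r₂ ↦ (r₂ - r₁) * W₁) (𝓝[<] t₀) (𝓝 ((t₀ - r₁) * W₁)) :=
    (((continuous_id.sub continuous_const).mul continuous_const).tendsto t₀).mono_left
      nhdsWithin_le_nhds
  have h2 : Tendsto (fun r₂ ↦ (t₀ - r₁) * N r₁ - (t₀ - r₂) * N r₂) (𝓝[<] t₀)
      (𝓝 ((t₀ - r₁) * N r₁ - 0)) := tendsto_const_nhds.sub hlim
  rw [sub_zero] at h2
  have h3 : (t₀ - r₁) * W₁ ≤ (t₀ - r₁) * N r₁ :=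
    le_of_tendsto_of_tendsto h1 h2 (by
      filter_upwards [Ioo_mem_nhdsLT hr₁.2] with r₂ hr₂ using hsand r₂ hr₂)
  exact le_of_mul_le_mul_left h3 (sub_pos.2 hr₁.2)

/-- **`τ 𝒩(τ) = ∫₀^τ 𝒲` for the conjugate heat kernel, limit form** (Bamler 2020a, Prop. 5.2,
first identity integrated from the pole): `∫_{r₁}^{r₂} 𝒲 ds → (t₀ − r₁) 𝒩(r₁)` as `r₂ → t₀⁻`.
[cite: Bamler2020Entropy, §5.1, Prop. 5.2] -/
theorem IsRicciFlow.tendsto_integral_kernelWEntropy (hm : 3 ≤ m) {t₀ : ℝ} (ht₀ : t₀ ∈ Ioc a T)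
    (x₀ : M) {r₁ : ℝ} (hr₁ : r₁ ∈ Ioo a t₀) :
    Tendsto (fun r₂ ↦ ∫ s in r₁..r₂, (g s).wEntropy (cov s)
        (entropyPotential (fun r y ↦ hflow.heatKernelFn hh hR' t₀ x₀ (y, r)) m t₀ s) (t₀ - s))
      (𝓝[<] t₀)
      (𝓝 ((t₀ - r₁) *
        pointedNashEntropy g (fun r y ↦ hflow.heatKernelFn hh hR' t₀ x₀ (y, r)) m t₀ r₁)) := by
  set N : ℝ → ℝ := fun r ↦
    pointedNashEntropy g (fun r y ↦ hflow.heatKernelFn hh hR' t₀ x₀ (y, r)) m t₀ r with hN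
  have hlim := hflow.tendsto_mul_kernelNashEntropy hh hR' hm ht₀ x₀
  have h2 : Tendsto (fun r₂ ↦ (t₀ - r₁) * N r₁ - (t₀ - r₂) * N r₂) (𝓝[<] t₀)
      (𝓝 ((t₀ - r₁) * N r₁ - 0)) := tendsto_const_nhds.sub hlim
  rw [sub_zero] at h2
  refine h2.congr' ?_
  filter_upwards [Ioo_mem_nhdsLT hr₁.2] with r₂ hr₂
  have hflow' : IsRicciFlow g cov (Icc r₁ r₂) :=
    hflow.mono (Icc_subset_Icc hr₁.1.le (hr₂.2.le.trans ht₀.2))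
  exact hflow'.mul_kernelNashEntropy_sub_eq_integral hh hR' (hflow.heatKernelFn_contMDiffOn hh hR' ht₀ x₀)
    (fun p hp ↦ hflow.heatKernelFn_pos hh hR' ht₀ x₀ hp)
    (fun s hs ↦ hflow.heatKernelMeasure_eq_withDensity_heatKernelFn hh hR' ht₀ x₀ hs)
    (fun p hp ↦ hflow.deriv_heatKernelFn_time hh hR' ht₀ x₀ hp) hr₁.1 hr₂.1 hr₂.2

end Pole

end Literature.Geometry.Riemannian

end
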